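import Summits.RiemannHypothesis.RiemannHypothesis.Theorems.OddSectorOddOneSignedWindowsFoldCriterion
import Summits.RiemannHypothesis.RiemannHypothesis.Theorems.OddSectorOddOneSignedWindowsRenorm
import HarnessLib

/-!
# The crux `OddOneSignedWindows` IS the absence of sign-opposed reflected prime pairs
# (helper for crux `OddSector.OddOneSignedWindows`, item stmt-RiemannHypothesis-17778; RH-free)

The fold criterion (`goodWindow_of_noOpposedReflections`,
`Theorems/OddSectorOddOneSignedWindowsFoldCriterion.lean`) says that a real odd-sector ground state
without sign-opposed reflected pairs certifies a good window; conversely a one-signed real ground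
state has no sign-opposed pair (the reflection `s ↦ log n − s` preserves Lebesgue measure). Hence
(`oddOneSignedWindows_iff_noOpposedReflections`) the route crux is EQUIVALENT, RH-free, to

  `NoOpposedReflections`: beyond every height some window `a` carries a real odd-sector ground state
  `u` with `Re u(s) · Re u(log n − s) ≥ 0` for a.e. `s` with `s, log n − s ∈ (0, a)`, for every
  prime length `log n < 2a`

— the transfer of the `OddArchAnchor` folding argument isolates the obstruction EXACTLY in the
reflected prime atoms (crux strategy census `STRATEGY-CENSUS.md`, switch "Transfer", residue
`NoOpposedReflections`; its `residue_iff` was kernel-checked there modulo the fold criterion, which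
is now a theorem). No difficulty is moved — the sign question for the unknown minimiser is the
arithmetic of its reflected pairs `s + s' = log n` — but the crux is now typed as a statement about
the ground state's values on finitely many reflected pairs of sub-intervals of `(0, a)` rather than
on all of `(0, a)`: the origin layer, the edge layer and the bulk between consecutive
`log n − a` are free.

References: 2001 programme, route `odd-sector-eigenfunction-sign` (ATTEMPTS 2026-08-10,
"variational negativity criterion"; Rem 11.20(3)); crux dir `STRATEGY-CENSUS.md` (2026-08-17).
-/

noncomputable section

set_option linter.dupNamespace false

open MeasureTheory Set Filter
open scoped Topology

namespace Summit.RiemannHypothesis.RiemannHypothesis.Theorems.OddSector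

open Literature.NumberTheory.LFunctions

/-- **A one-signed function has no sign-opposed reflected pair**: if `Re v ≥ 0` a.e. on `(0, a)`
then `Re v(s) · Re v(log n − s) ≥ 0` for a.e. `s` with `s, log n − s ∈ (0, a)` (the reflection
`s ↦ log n − s` preserves Lebesgue measure). [folklore] -/
theorem noOpposedReflections_of_ae_nonneg {a c : ℝ} {v : ℝ → ℂ}
    (hv : ∀ᵐ t : ℝ, t ∈ Ioo 0 a → 0 ≤ (v t).re) :
    ∀ᵐ s : ℝ, s ∈ Ioo 0 a → c - s ∈ Ioo 0 a → 0 ≤ (v s).re * (v (c - s)).re := by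
  have hrefl : ∀ᵐ s : ℝ, (c - s) ∈ Ioo 0 a → 0 ≤ (v (c - s)).re :=
    (Measure.measurePreserving_sub_left (volume : Measure ℝ) c).quasiMeasurePreserving.tendsto_ae.eventually
      hv
  filter_upwards [hv, hrefl] with s h1 h2 hs hcs
  exact mul_nonneg (h1 hs) (h2 hcs)

/-- **The crux reworded (RH-free equivalence, registered sub-goal
`oddOneSignedWindows_iff_noOpposedReflections` of item stmt-RiemannHypothesis-17778).**
`OddOneSignedWindows` holds iff beyond every height some window carries a REAL odd-sector ground
state WITHOUT SIGN-OPPOSED REFLECTED PAIRS: for every prime length `log n < 2a`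
(`n ∈ weilPrimeIndex a`), `Re u(s) · Re u(log n − s) ≥ 0` for a.e. `s` with `s, log n − s ∈ (0, a)`.
(`→`: a one-signed real ground state, `oddOneSignedWindows_iff_real_nonneg`, has no opposed pair;
`←`: the fold criterion `goodWindow_of_noOpposedReflections`.) [folklore] -/
theorem oddOneSignedWindows_iff_noOpposedReflections :
    Summit.RiemannHypothesis.RiemannHypothesis.Theses.OddSector.OddOneSignedWindows ↔
      ∀ A : ℝ, ∃ a : ℝ, A ≤ a ∧ ∃ u : ℝ → ℂ, IsWeilOddGroundState a u ∧ (∀ t, (u t).im = 0) ∧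
        ∀ n ∈ weilPrimeIndex a, ∀ᵐ s : ℝ, s ∈ Ioo 0 a → Real.log n - s ∈ Ioo 0 a →
          0 ≤ (u s).re * (u (Real.log n - s)).re := by
  constructor
  · rw [oddOneSignedWindows_iff_real_nonneg]
    intro H A
    obtain ⟨a, hAa, v, hv, hreal, hsign⟩ := H A
    exact ⟨a, hAa, v, hv, hreal, fun n _ ↦ noOpposedReflections_of_ae_nonneg hsign⟩
  · intro H
    rw [oddOneSignedWindows_iff]
    intro A
    obtain ⟨a, hAa, u, hu, hreal, hpairs⟩ := H A
    obtain ⟨v, hv, hsign⟩ := goodWindow_of_noOpposedReflections a u hu hreal hpairs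
    exact ⟨a, hAa, v, hv, hsign⟩

/-- **Negative reading**: `OddOneSignedWindows` FAILS iff beyond some height EVERY real odd-sector
ground state of EVERY window has a sign-opposed reflected pair of positive measure at some prime
length `log n < 2a`. [folklore] -/
theorem not_oddOneSignedWindows_iff_forall_opposedReflection :
    ¬ Summit.RiemannHypothesis.RiemannHypothesis.Theses.OddSector.OddOneSignedWindows ↔
      ∃ A : ℝ, ∀ a : ℝ, A ≤ a → ∀ u : ℝ → ℂ, IsWeilOddGroundState a u → (∀ t, (u t).im = 0) →
        ∃ n ∈ weilPrimeIndex a, ¬ (∀ᵐ s : ℝ, s ∈ Ioo 0 a → Real.log n - s ∈ Ioo 0 a →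
          0 ≤ (u s).re * (u (Real.log n - s)).re) := by
  rw [oddOneSignedWindows_iff_noOpposedReflections]
  push Not
  rfl

end Summit.RiemannHypothesis.RiemannHypothesis.Theorems.OddSector

end
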